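import Summits.BirchSwinnertonDyer.BirchSwinnertonDyer.Theses.PrintX8VS

/-! # PrintX8VS — closer for the split glue item `CyclotomicLowerPosLevelX8OfGuardedPartsC` (stmt-BirchSwinnertonDyer-23403)

Route `PrintX8VS` rev 17/18 (x8 planner g33, C′ RE-KEYED H-GUARD, director-bsd (259)(b) / (266) R1′ / (267)(A)):
the x8-only item 22901 `CyclotomicLowerPosLevelX8` (S4b-cyc) was RE-split (gen 2) into child 1
`KatoSporadicPosLevelGivenHeldX8C` (K_spor ∧ S4b-cyc behind the three held print facts Sp12 Thm 7.14, Thm 7.16 in its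
print-faithful γ⁻¹ keying = `Sprung2012.thm716_sharpFlatCharIdeal_divisibility_contra`, period unit at 3) and child 2
`HeldFactsKatoSporadicX8C` (those three facts, held). The generated glue item
`CyclotomicLowerPosLevelX8OfGuardedPartsC := child 1 → child 2 → CyclotomicLowerPosLevelX8` is the projection proved
below (pure logic; nothing about BSD, K1, K_spor, S4b-cyc or Thm 7.16 is proved here). Land with
`ledger propose --kind proof --target Summits/BirchSwinnertonDyer/BirchSwinnertonDyer/Theorems/PrintX8VSCyclotomicLowerPosLevelX8OfGuardedPartsC.lean --file <this> --workitem stmt-BirchSwinnertonDyer-23403`.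
The W-83 (gen-1) glue 23114 and children 23112/23113 are RETIRED (decls no longer rendered). -/

namespace Summit.BirchSwinnertonDyer.BirchSwinnertonDyer.Theorems.PrintX8VSGuardedPartsC

open Summit.BirchSwinnertonDyer.BirchSwinnertonDyer.Theses.PrintX8VS

/-- The gen-2 split glue of item 22901: child 1 applied to the three conjuncts of child 2, second component. -/
theorem cyclotomicLowerPosLevelX8OfGuardedPartsC_holds : CyclotomicLowerPosLevelX8OfGuardedPartsC :=
  fun hRes hF => (hRes hF.1 hF.2.1 hF.2.2).2

/-- Companion (not an item): conjuncts 1 and 3 of child 2 are binders the route already holds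
(`PublishedInputsX8Core` (4); `HeldInputsX8R` (ii)); conjunct 2 (Thm 7.16, γ⁻¹-keyed) is the NEW held input —
it is NOT conjunct (5) of `PublishedInputsX8Core` (that one is the γ-keyed sibling), so child 2 is displayed on its own. -/
theorem heldFactsKatoSporadicX8C_of_held (hHeld : HeldInputsX8R) (hCore : PublishedInputsX8Core)
    (h716c : Literature.NumberTheory.EllipticCurves.Sprung2012.thm716_sharpFlatCharIdeal_divisibility_contra) :
    HeldFactsKatoSporadicX8C :=
  ⟨hCore.2.2.2.1, h716c, hHeld.2.1⟩

/-- Companion (not an item): any facts-door of the C′ shape (the LEAD's ι-door pair re-registered on 23401, or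
p654628-style plumbing with `hfacts := ⟨h714, h716c, h3⟩`) closes child 1 with this one line. -/
theorem katoSporadicPosLevelGivenHeldX8C_of_factsDoor
    (door : HeldFactsKatoSporadicX8C → KatoFineLowerSporadicX8 ∧ CyclotomicLowerPosLevelX8) :
    KatoSporadicPosLevelGivenHeldX8C :=
  fun h714 h716c h3 => door ⟨h714, h716c, h3⟩

/-- Companion (not an item): the bare pair closes child 1 outright (guards unused). -/
theorem katoSporadicPosLevelGivenHeldX8C_of_pair (h : KatoFineLowerSporadicX8 ∧ CyclotomicLowerPosLevelX8) :
    KatoSporadicPosLevelGivenHeldX8C :=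
  fun _ _ _ => h

end Summit.BirchSwinnertonDyer.BirchSwinnertonDyer.Theorems.PrintX8VSGuardedPartsC
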